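import Mathlib
import HarnessLib
import Summits.ValiantsHypothesis.ValiantsHypothesis.Theses.ValuativeGCT
import Literature.Computability.Complexity.OccurrenceObstructionsIPProofs

/-!
# Line `per-anchor-catch-up` — checked skeleton for crux `ValuativeGCT.ValuativeFlip`
(stmt-ValiantsHypothesis-12624; crux-plan round 1; card `Cruxes/ValuativeFlip/Ideas/per-anchor-catch-up.md`,
line card `Cruxes/ValuativeFlip/Lines/per-anchor-catch-up.md`)

THE LINE. Anchor the PER side of the flip at the padding-free, `m`-free function
`P_n(μ) := mult_{μ*} ℂ[Δ_n(per_n)] = orbitMultiplicity ℂ (paddedPerFormLex ℂ n n) n (partitionWeightLex n μ)`,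
transport it to every determinant size `m = n + j` along the Kadish–Landsberg / IP17 Prop. 2.6(b)
inheritance `P_n(μ) ≤ mult_{(μ♯m)*} ℂ[Δ_m(X₀₀^{m-n} per_n)]`, `μ♯m = (μ₁ + jδ, μ₂, …) = rowLift μ j`
(`stub_perAnchorInheritance`, known in print), and ask the route's DET side — the valuative truncation
`T_U(μ♯m)` of the crux, verbatim — to stay below the anchor. The window `n ≤ m ≤ 2^((log₂ n + c)^c)`
splits into three regimes with three different owners (triage r1-2 (D) / r1-3 (P3): padded power sums
give `K_m((μ♯m)*) ≥ a_μ(δ[n]) ≥ P_n(μ)` whenever `δ ≤ n²` and `m ≥ (n-1)δ + 1`, so an anchored witness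
at `(n, m)` has `δ > min(n², (m-1)/(n-1))`):

* BOTTOM `m = n`: free — `U = ⊥`, no cut, Hilbert-function count `dim Δ(per_n) = n⁴ - 2n + 2 >
  n⁴ - 2n² + 2 = dim End(W)⫽Stab(det_n)` (`stub_bottomFlip`; = Disproof.lean docblock F2, informal there).
* HEAD `n < m ≤ (n-1)n²` (polynomial padding, `c`-free): bounded-degree witnesses are possible, the
  live clause is `m ≤ (n-1)δ` (short padding relative to the degree); technology = explicit
  highest-weight vectors / evaluation certificates at `per_n`, kit-sized at `n = 3`, `m = 4…18`,
  `δ ≥ max(5, m/2)`; consequence already `dc(per_n) > (n-1)n²`, the first superquadratic bound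
  (`stub_anchoredFlipHead`).
* TAIL `(n-1)n² < m ≤ 2^((log₂ n + c)^c)` (quasi-polynomial padding): `δ > n²` is forced, so only
  GROWTH engines for `P_n` (cards `phi-cleared-permanent-orbit`, `big-cell-semigroup-floor`) against an
  asymptotic det-side census (cards `skew-restriction-rank`, `koszul-edmonds-amplification`) can decide
  it (`stub_anchoredFlipTail`, the hardest stub).

`ValuativeFlip_of : ValuativeFlip` (the route decl BY NAME, no hypotheses) is assembled from the four
stubs and nothing else: `n₀ := max (max n_head n_tail(c)) 3`, `m = n` ↦ bottom (`U = ⊥`, `r = 0`, rank of the zero matrix), `m = n + j` ↦ head or tail by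
`m ≤ (n-1)n²`, `λ := rowLift μ j` (`ℓ(λ) ≤ max(ℓ(μ),1) ≤ m²`, `card_parts_rowLift_le`) and
`dim T_U(λ) < P_n(μ) ≤ mult_{λ*} ℂ[Δ_m(X₀₀^{m-n} per_n)]`. Sorries only inside `stub_*`; modulo the
four stubs `ValuativeFlip_of` uses propext / Classical.choice / Quot.sound only (the audit lists the stubs as its support).
-/

namespace Summit.ValiantsHypothesis.ValiantsHypothesis.Cruxes.ValuativeFlip.PerAnchorCatchUp

open scoped BigOperators Matrix
open Literature.NumberTheory.DiophantineGeometry Literature.Computability.AlgebraicComplexity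
open Literature.Computability.Complexity

/-- **stub_perAnchorInheritance** — PER-SIDE ANCHOR TRANSPORT (known in print: Kadish–Landsberg 2014
§ (padded polynomials) = Landsberg 2017 Prop. 8.4.2.x; Ikenmeyer–Panova, arXiv:1512.03798, held
Prop. 13(b) p. 6: "from a highest weight vector `P` of weight `λ ⊢ md` in `Sym^d(V_m)` they construct a
highest weight vector `P^{♯n}` of weight `λ + (d(n-m))` … such that `P(f) = P^{♯n}(f^{♯n})`", run on the
orbit closure `Δ_n(per_n)` in place of `V_n`; BIP19 arXiv:1604.06431 §4–5). For `μ ⊢ nδ` with at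
most `n²` parts and every `j`: the multiplicity of `μ*` in `ℂ[Δ_n(per_n)]` (`paddedPerFormLex ℂ n n`,
no padding) is at most the multiplicity of `(μ♯(n+j))*` in the coordinate ring of the orbit closure of
the route's padded permanent `paddedPerFormLex ℂ n (n+j) = X₀₀^j · per_n(bottom-right block)`.
Lean route: the tree's lift `liftHWV` / `liftHWV_mem_highestWeightSpace` (weight
`partitionWeightLex_rowLift`) and `aeval_formCoeff_paddedForm_liftHWV` exactly as in
`plethysmCoeff_le_orbitMultiplicity_rowLift`, with `Ω_N` replaced by `Δ(X₀₀^j per_n)`; the one new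
point is that the inner-padded forms `X_top^j · f`, `f ∈ Δ_n(per_n)`, lie in `Δ_{n+j}(X₀₀^j per_n)`
(fresh padding has the LARGER closure: substitute `X₀₀ ↦ X_top`, `endOrbit_subset_orbitClosure`,
plus a permutation of `MatIdx (n+j)`), and that BIP's normalised lift (exact evaluation) or the
`Δ`-rescaled evaluation on general points of the orbit is used for injectivity. Size M. -/
theorem stub_perAnchorInheritance :
    ∀ (n j δ : ℕ) [NeZero n] [NeZero (n + j)] (μ : Nat.Partition (n * δ)), μ.parts.card ≤ n * n →
      orbitMultiplicity ℂ (paddedPerFormLex ℂ n n) n (partitionWeightLex n μ) ≤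
        orbitMultiplicity ℂ (paddedPerFormLex ℂ n (n + j)) (n + j)
          (partitionWeightLex (n + j) (rowLift μ j)) := by
  sorry

/-- **stub_bottomFlip** — THE BOTTOM OF EVERY WINDOW IS FREE (`m = n`, `U = ⊥`, `r = 0`; the card's
`BottomFlip`, found independently as docblock F2 / `squareCase` of the standing disprover's
Disproof.lean, where it is informal). For `n ≥ 3` there are `δ` and `λ ⊢ nδ` (`≤ n²` parts) such
that the crux's truncation at `U = ⊥`, `r = 0` — equal to the full space `T₀(λ)` of
`Stab_End(det_n)`-invariant highest-weight vectors of weight `λ*` in `ℂ[End W]_{nδ}` (the symmetric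
Kronecker count `sk(λ; δ^n)`), because `I(L_⊥) = I({0}) = 𝔪` contains every form of degree `nδ` to
order `nδ` — has dimension `< P_n(λ)`. Why true: Krull dimensions `dim ℂ[Δ(per_n)] = n⁴ - dim
Stab_{GL}(per_n) = n⁴ - 2n + 2` (Marcus–May 1962 / Botta 1967: `Stab(per_n) = (T·(S_n × S_n)) ⋊ ℤ/2`,
`dim = 2n - 2`) against `dim ℂ[End W]^{Stab det_n} ≤ n⁴ - dim Stab(det_n) = n⁴ - 2n² + 2`; Hilbert–Serre
makes `Σ_λ P_n(λ) dim V_λ(GL_{n²})` eventually exceed `Σ_λ sk(λ) dim V_λ`, so some `λ` flips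
(non-constructive; `n = 2` is correctly excluded: `Stab(per₂) ≅ GO₄`, both sides `10`-dimensional).
Respects Disproof §OneRow (the flipping `λ` has `≥ 2` rows automatically) and §MOne. Size L in Lean
(GK dimension of an invariant ring and of an orbit closure), covers the single size `m = n`. -/
theorem stub_bottomFlip :
    ∀ (n : ℕ) [NeZero n], 3 ≤ n → ∃ (δ : ℕ) (lam : Nat.Partition (n * δ)), lam.parts.card ≤ n * n ∧
      (let χ : Weight (MatIdx n) := (Weight.dualOfPartition (n * n) lam).toMatIdx
       let T : Submodule ℂ (MvPolynomial (MatIdx n × MatIdx n) ℂ) :=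
         MvPolynomial.homogeneousSubmodule (MatIdx n × MatIdx n) ℂ (n * δ) ⊓
         ((MvPolynomial.vanishingIdeal ℂ
             {p : MatIdx n × MatIdx n → ℂ | ∀ j : MatIdx n, (fun i => p (j, i)) ∈ (⊥ : Submodule ℂ (MatIdx n → ℂ))}) ^
               (δ * (n - 0))).restrictScalars ℂ ⊓
         (⨅ (M : Matrix (MatIdx n) (MatIdx n) ℂ) (_ : linSubst (MatIdx n) ℂ M (detFormLex ℂ n) = detFormLex ℂ n),
             LinearMap.ker ((MvPolynomial.aeval (R := ℂ) fun p : MatIdx n × MatIdx n =>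
                 ∑ l : MatIdx n, M l p.2 • MvPolynomial.X (p.1, l)).toLinearMap -
               LinearMap.id (R := ℂ) (M := MvPolynomial (MatIdx n × MatIdx n) ℂ))) ⊓
         (⨅ (g : Matrix.GeneralLinearGroup (MatIdx n) ℂ) (_ : IsUpperTriangular g),
             LinearMap.ker ((MvPolynomial.aeval (R := ℂ) fun p : MatIdx n × MatIdx n =>
                 ∑ l : MatIdx n, ((g⁻¹ : Matrix.GeneralLinearGroup (MatIdx n) ℂ) :
                   Matrix (MatIdx n) (MatIdx n) ℂ) p.1 l • MvPolynomial.X (l, p.2)).toLinearMap -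
               weightChar χ g • LinearMap.id (R := ℂ) (M := MvPolynomial (MatIdx n × MatIdx n) ℂ)))
       Module.finrank ℂ ↥T < orbitMultiplicity ℂ (paddedPerFormLex ℂ n n) n χ) := by
  sorry

/-- **stub_anchoredFlipHead** — ANCHORED FLIP IN THE POLYNOMIAL HEAD `n < m ≤ (n-1)n²` (the card's
Transfer C⁺ restricted to short paddings; `c`-free; open — together with `ValuativeBound` (stmt-12625)
and `GctMultPrinciple` it already gives `dc(per_n) > (n-1)n²`, beyond the quadratic state of the art). For all large `n` and every `m = n + j` with `1 ≤ j` and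
`m ≤ (n-1)n²` there are a degree `δ` with `m ≤ (n-1)δ` (the live clause of triage (D): for
`m ≥ (n-1)δ + 1`, `δ ≤ n²`, padded power sums force `K_m((μ♯m)*) ≥ a_μ(δ[n]) ≥ P_n(μ)`, and in the head
`δ > n²` already implies the clause — so, given `ValuativeBound`, it loses nothing), a shape `μ ⊢ nδ` with `≤ n²` parts (so
`μ♯m` is Kadish–Landsberg admissible and `|μ̄|` may exceed `m`: the Kronecker-UNSTABLE range, where
Manivel's freezing `kroneckerCoeff_rowLift_le` and IP17 Prop. 2.8 do not bite), and a linear space `U`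
of `m × m` matrices of rank `≤ r` (useful `U`: Edmonds-gap spaces — Disproof §NullCone shows compression
spaces give `T_U = T₀`; `U = ⊥` is an anchored symmetric-Kronecker flip) such that the crux's truncation
`T_U(μ♯m)` (verbatim, threshold `δ(m - r)`) has dimension `< P_n(μ)`. Technology: explicit
highest-weight vectors of `Sym^δ Sym^n ℂ^{n²}` evaluated on `End·per_n` (per side, once per `n`) and
the jet/restriction census of `T_U` (det side); first live instances `(n, m, δ) = (3, 4…18, ≥ max(5, m/2))`
(at `n = 3`, `δ ≤ 4` is dead for every `m` by the explicit Fermat determinants of triage r1-2). By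
triage r1-3 P2 witnesses have `4 ≤ ℓ(μ) ≤ min(n², δ)`. Size: open (L+). -/
theorem stub_anchoredFlipHead :
    ∃ n₀ : ℕ, ∀ (n : ℕ) [NeZero n], n₀ ≤ n → ∀ (j : ℕ) [NeZero (n + j)], 1 ≤ j →
      n + j ≤ (n - 1) * (n * n) →
      ∃ (δ : ℕ) (μ : Nat.Partition (n * δ)) (U : Submodule ℂ (MatIdx (n + j) → ℂ)) (r : ℕ),
        (∀ u ∈ U, (Matrix.of fun a b : Fin (n + j) => u (toLex (a, b))).rank ≤ r) ∧
        μ.parts.card ≤ n * n ∧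
        n + j ≤ (n - 1) * δ ∧
        (let χ : Weight (MatIdx (n + j)) :=
           (Weight.dualOfPartition ((n + j) * (n + j)) (rowLift μ j)).toMatIdx
         let T : Submodule ℂ (MvPolynomial (MatIdx (n + j) × MatIdx (n + j)) ℂ) :=
           MvPolynomial.homogeneousSubmodule (MatIdx (n + j) × MatIdx (n + j)) ℂ ((n + j) * δ) ⊓
           ((MvPolynomial.vanishingIdeal ℂ
               {p : MatIdx (n + j) × MatIdx (n + j) → ℂ | ∀ j' : MatIdx (n + j), (fun i => p (j', i)) ∈ U}) ^
                 (δ * ((n + j) - r))).restrictScalars ℂ ⊓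
           (⨅ (M : Matrix (MatIdx (n + j)) (MatIdx (n + j)) ℂ)
               (_ : linSubst (MatIdx (n + j)) ℂ M (detFormLex ℂ (n + j)) = detFormLex ℂ (n + j)),
               LinearMap.ker ((MvPolynomial.aeval (R := ℂ) fun p : MatIdx (n + j) × MatIdx (n + j) =>
                   ∑ l : MatIdx (n + j), M l p.2 • MvPolynomial.X (p.1, l)).toLinearMap -
                 LinearMap.id (R := ℂ) (M := MvPolynomial (MatIdx (n + j) × MatIdx (n + j)) ℂ))) ⊓
           (⨅ (g : Matrix.GeneralLinearGroup (MatIdx (n + j)) ℂ) (_ : IsUpperTriangular g),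
               LinearMap.ker ((MvPolynomial.aeval (R := ℂ) fun p : MatIdx (n + j) × MatIdx (n + j) =>
                   ∑ l : MatIdx (n + j), ((g⁻¹ : Matrix.GeneralLinearGroup (MatIdx (n + j)) ℂ) :
                     Matrix (MatIdx (n + j)) (MatIdx (n + j)) ℂ) p.1 l • MvPolynomial.X (l, p.2)).toLinearMap -
                 weightChar χ g • LinearMap.id (R := ℂ) (M := MvPolynomial (MatIdx (n + j) × MatIdx (n + j)) ℂ)))
         Module.finrank ℂ ↥T < orbitMultiplicity ℂ (paddedPerFormLex ℂ n n) n (partitionWeightLex n μ)) := by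
  sorry

/-- **stub_anchoredFlipTail** — ANCHORED FLIP IN THE QUASI-POLYNOMIAL TAIL `(n-1)n² < m ≤ 2^((log₂ n + c)^c)`
(the card's Transfer C⁺ on long paddings; the HARDEST stub, open, `VP ≠ VNP`-strength). For every `c`,
all large `n` and every `m = n + j` in the tail of the window there are a degree `δ > n²` (forced:
triage (D) kills `δ ≤ n²` as soon as `m ≥ (n-1)δ + 1`, which holds throughout the tail; triage r1-3 P3
gives the same from `m ≥ m_ps(n) ≤ n³` via the secant variety of the Veronese), a shape `μ ⊢ nδ` with
`≤ n²` parts and a linear space `U` of `m × m` matrices of rank `≤ r` such that the crux's truncation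
`T_U(μ♯m)` has dimension `< P_n(μ)`. Since `δ > n²` puts `P_n` out of reach of direct linear algebra
already at `n = 3` (degree `≥ 30` in `81` variables), this stub stands or falls with a per-side GROWTH
engine for `δ ↦ P_n(μ(δ))` — the docking points are the companion crux cards `phi-cleared-permanent-orbit`
(BI17 localisation: `mult ≥ pk_n` at `Φ`-shifted weights) and `big-cell-semigroup-floor` (mixed-sumset
growth of leading exponents), composed with this line's anchor — against an asymptotic det-side census of
`T_U` for a coherent Edmonds-gap family `U_m` (`skew-restriction-rank`, `koszul-edmonds-amplification`).
Catch-up reading (card): with `m*(μ) := sup {m : some T_U(μ♯m) stays below P_n(μ)}` the stub says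
`sup_μ m*(μ)` outgrows every `2^((log₂ n + c)^c)`; the route's kill statement `NoValuativeFlip`
(stmt-12629, `m ≥ n^{c₀}`) is exactly `sup_μ m*(μ) ≤ n^{c₀}` and refutes this stub (not the head when
`c₀ > 3`). Size: open (XL). -/
theorem stub_anchoredFlipTail :
    ∀ c : ℕ, ∃ n₀ : ℕ, ∀ (n : ℕ) [NeZero n], n₀ ≤ n → ∀ (j : ℕ) [NeZero (n + j)],
      (n - 1) * (n * n) < n + j → n + j ≤ 2 ^ ((Nat.log 2 n + c) ^ c) →
      ∃ (δ : ℕ) (μ : Nat.Partition (n * δ)) (U : Submodule ℂ (MatIdx (n + j) → ℂ)) (r : ℕ),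
        (∀ u ∈ U, (Matrix.of fun a b : Fin (n + j) => u (toLex (a, b))).rank ≤ r) ∧
        μ.parts.card ≤ n * n ∧
        n * n < δ ∧
        (let χ : Weight (MatIdx (n + j)) :=
           (Weight.dualOfPartition ((n + j) * (n + j)) (rowLift μ j)).toMatIdx
         let T : Submodule ℂ (MvPolynomial (MatIdx (n + j) × MatIdx (n + j)) ℂ) :=
           MvPolynomial.homogeneousSubmodule (MatIdx (n + j) × MatIdx (n + j)) ℂ ((n + j) * δ) ⊓
           ((MvPolynomial.vanishingIdeal ℂ
               {p : MatIdx (n + j) × MatIdx (n + j) → ℂ | ∀ j' : MatIdx (n + j), (fun i => p (j', i)) ∈ U}) ^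
                 (δ * ((n + j) - r))).restrictScalars ℂ ⊓
           (⨅ (M : Matrix (MatIdx (n + j)) (MatIdx (n + j)) ℂ)
               (_ : linSubst (MatIdx (n + j)) ℂ M (detFormLex ℂ (n + j)) = detFormLex ℂ (n + j)),
               LinearMap.ker ((MvPolynomial.aeval (R := ℂ) fun p : MatIdx (n + j) × MatIdx (n + j) =>
                   ∑ l : MatIdx (n + j), M l p.2 • MvPolynomial.X (p.1, l)).toLinearMap -
                 LinearMap.id (R := ℂ) (M := MvPolynomial (MatIdx (n + j) × MatIdx (n + j)) ℂ))) ⊓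
           (⨅ (g : Matrix.GeneralLinearGroup (MatIdx (n + j)) ℂ) (_ : IsUpperTriangular g),
               LinearMap.ker ((MvPolynomial.aeval (R := ℂ) fun p : MatIdx (n + j) × MatIdx (n + j) =>
                   ∑ l : MatIdx (n + j), ((g⁻¹ : Matrix.GeneralLinearGroup (MatIdx (n + j)) ℂ) :
                     Matrix (MatIdx (n + j)) (MatIdx (n + j)) ℂ) p.1 l • MvPolynomial.X (l, p.2)).toLinearMap -
                 weightChar χ g • LinearMap.id (R := ℂ) (M := MvPolynomial (MatIdx (n + j) × MatIdx (n + j)) ℂ)))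
         Module.finrank ℂ ↥T < orbitMultiplicity ℂ (paddedPerFormLex ℂ n n) n (partitionWeightLex n μ)) := by
  sorry

/-- **Composition** — the crux `ValuativeGCT.ValuativeFlip` (the route decl, BY NAME) from the four
declared stubs `stub_perAnchorInheritance`, `stub_bottomFlip`, `stub_anchoredFlipHead`,
`stub_anchoredFlipTail` and nothing else (logically: `inherit → bottom → head → tail → ValuativeFlip`;
the audit reads the dependence off the proof term, and the skeleton becomes the crux proof once the
stubs are sorry-free). Bookkeeping only: `n₀ := max (max n_head n_tail(c)) 3`; `m = n` ↦ bottom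
witness with `U = ⊥`, `r = 0` (rank of the zero matrix); `m = n + j`, `j ≥ 1` ↦ head or tail according
to `m ≤ (n-1)n²`; `λ := μ♯m = rowLift μ j` with `ℓ(λ) ≤ max(ℓ(μ), 1) ≤ m²` (`card_parts_rowLift_le`);
finally `dim T_U(λ) < P_n(μ) ≤ mult_{λ*} ℂ[Δ_m(X₀₀^{m-n} per_n)]` by the inheritance. No `sorry` here;
axioms of this declaration minus the stubs: propext, Classical.choice, Quot.sound. -/
theorem ValuativeFlip_of :
    Summit.ValiantsHypothesis.ValiantsHypothesis.Theses.ValuativeGCT.ValuativeFlip := by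
  have hInh := stub_perAnchorInheritance
  have hBot := stub_bottomFlip
  have hHead := stub_anchoredFlipHead
  have hTail := stub_anchoredFlipTail
  intro c
  obtain ⟨nH, hnH⟩ := hHead
  obtain ⟨nT, hnT⟩ := hTail c
  refine ⟨max (max nH nT) 3, ?_⟩
  intro n hn m _ hnm hm
  have hnH' : nH ≤ n := (le_max_left _ _).trans (le_of_max_le_left hn)
  have hnT' : nT ≤ n := (le_max_right _ _).trans (le_of_max_le_left hn)
  have hn3 : 3 ≤ n := le_of_max_le_right hn
  haveI hn0 : NeZero n := ⟨by omega⟩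
  rcases hnm.eq_or_lt with rfl | hlt
  · -- BOTTOM `m = n`: `U = ⊥`, `r = 0`
    obtain ⟨δ, lam, hcard, hflip⟩ := hBot n hn3
    refine ⟨⊥, 0, δ, lam, ?_, hcard, ?_⟩
    · intro u hu
      rw [Submodule.mem_bot] at hu
      subst hu
      have h0 : (Matrix.of fun a b : Fin n => (0 : MatIdx n → ℂ) (toLex (a, b))) = 0 := by
        ext a b
        simp
      rw [h0, Matrix.rank_zero]
    · simpa using hflip
  · -- ABOVE THE BOTTOM `m = n + j`, `j ≥ 1`: head or tail
    obtain ⟨j, rfl⟩ : ∃ j, m = n + j := ⟨m - n, by omega⟩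
    have hj : 1 ≤ j := by omega
    -- a witness `(δ, μ, U, r)` of the anchored flip at `(n, n + j)`, from the head or from the tail
    have hw : ∃ (δ : ℕ) (μ : Nat.Partition (n * δ)) (U : Submodule ℂ (MatIdx (n + j) → ℂ)) (r : ℕ),
        (∀ u ∈ U, (Matrix.of fun a b : Fin (n + j) => u (toLex (a, b))).rank ≤ r) ∧
        μ.parts.card ≤ n * n ∧
        (let χ : Weight (MatIdx (n + j)) :=
           (Weight.dualOfPartition ((n + j) * (n + j)) (rowLift μ j)).toMatIdx
         let T : Submodule ℂ (MvPolynomial (MatIdx (n + j) × MatIdx (n + j)) ℂ) :=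
           MvPolynomial.homogeneousSubmodule (MatIdx (n + j) × MatIdx (n + j)) ℂ ((n + j) * δ) ⊓
           ((MvPolynomial.vanishingIdeal ℂ
               {p : MatIdx (n + j) × MatIdx (n + j) → ℂ | ∀ j' : MatIdx (n + j), (fun i => p (j', i)) ∈ U}) ^
                 (δ * ((n + j) - r))).restrictScalars ℂ ⊓
           (⨅ (M : Matrix (MatIdx (n + j)) (MatIdx (n + j)) ℂ)
               (_ : linSubst (MatIdx (n + j)) ℂ M (detFormLex ℂ (n + j)) = detFormLex ℂ (n + j)),
               LinearMap.ker ((MvPolynomial.aeval (R := ℂ) fun p : MatIdx (n + j) × MatIdx (n + j) =>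
                   ∑ l : MatIdx (n + j), M l p.2 • MvPolynomial.X (p.1, l)).toLinearMap -
                 LinearMap.id (R := ℂ) (M := MvPolynomial (MatIdx (n + j) × MatIdx (n + j)) ℂ))) ⊓
           (⨅ (g : Matrix.GeneralLinearGroup (MatIdx (n + j)) ℂ) (_ : IsUpperTriangular g),
               LinearMap.ker ((MvPolynomial.aeval (R := ℂ) fun p : MatIdx (n + j) × MatIdx (n + j) =>
                   ∑ l : MatIdx (n + j), ((g⁻¹ : Matrix.GeneralLinearGroup (MatIdx (n + j)) ℂ) :
                     Matrix (MatIdx (n + j)) (MatIdx (n + j)) ℂ) p.1 l • MvPolynomial.X (l, p.2)).toLinearMap -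
                 weightChar χ g • LinearMap.id (R := ℂ) (M := MvPolynomial (MatIdx (n + j) × MatIdx (n + j)) ℂ)))
         Module.finrank ℂ ↥T < orbitMultiplicity ℂ (paddedPerFormLex ℂ n n) n (partitionWeightLex n μ)) := by
      rcases le_or_gt (n + j) ((n - 1) * (n * n)) with hhead | htail
      · obtain ⟨δ, μ, U, r, hU, hμ, _hclause, hflip⟩ := hnH n hnH' j hj hhead
        exact ⟨δ, μ, U, r, hU, hμ, hflip⟩
      · obtain ⟨δ, μ, U, r, hU, hμ, _hclause, hflip⟩ := hnT n hnT' j htail hm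
        exact ⟨δ, μ, U, r, hU, hμ, hflip⟩
    obtain ⟨δ, μ, U, r, hU, hμ, hflip⟩ := hw
    refine ⟨U, r, δ, rowLift μ j, hU, ?_, ?_⟩
    · exact (card_parts_rowLift_le μ j).trans (max_le (hμ.trans (Nat.mul_le_mul
        (Nat.le_add_right n j) (Nat.le_add_right n j))) (Nat.one_le_iff_ne_zero.2
        (mul_ne_zero (NeZero.ne (n + j)) (NeZero.ne (n + j)))))
    · have hle := hInh n j δ μ hμ
      simp only [] at hflip ⊢
      exact lt_of_lt_of_le hflip hle

end Summit.ValiantsHypothesis.ValiantsHypothesis.Cruxes.ValuativeFlip.PerAnchorCatchUp
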